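import Literature.MathematicalPhysics.QuantumFieldTheory.Balaban1983to89.B3Op116CollarRows
import Literature.MathematicalPhysics.QuantumFieldTheory.Balaban1983to89.B3Op116CollarSources

/-!
# Bałaban, *(Higgs)₂,₃ quantum fields in a finite volume III. Renormalization* [B3] — the kernel of the operator (1.16) p. 414 at
`n + n′ = 1` for a perturbation `P` supported FAR from the arguments: THE VALUE, DERIVATIVE AND MIXED ROWS of
`G_k(Ω,Y)V_k(P,Y)G_k(Ω,Y+P)` and `G_k(Ω,Y+P)V_k(P,Y)G_k(Ω,Y)` (`op116 … P Y 1 0 / 0 1`) from the (2.10) dictionary of the two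
propagators, exponentially small in the margin — file «CollarKernel» of the cell's Route δ for the class-(c) sentence of p. 433

statement-level skeleton of published theorems with citation tags; proofs where landed; nothing here is a claim about the Yang–Mills mass gap

T. Bałaban, Commun. Math. Phys. **88** (1983) 411–445 [cite: Balaban1983Higgs3]; part I, Commun. Math. Phys. **85** (1982) 603–636
[cite: Balaban1982Higgs1].  PDFs held: `paper:balaban1983-higgs-2-3-quantum-fields-finite-volume` (journal page = PDF page + 410;
p. 414 = `p0004.txt`, p. 426 = `p0016.txt`, p. 433 = `p0023.txt`).

CITATION HEADER (lean-in-tree rule).  Cell `lit-balaban` (HOME `run/shared/lean/pub/lit-balaban/`), Phase-2 proof seat **p40** gen 77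
(unit `lit-balaban-p40`, literature-prover-lit-balaban-p40-g77-0); free-target protocol G.5-34(d), TAKING line HOME/STATUS.md
2026-08-23T12:41:06Z (cc r15 = fold owner of rows B3.Txt@433 / B3.Prop1 / B3.Eq1.16 / B3.Eq2.5, p35, r14, p33); design note
`lit-balaban-p40/DESIGN-B3-116-box.md` v3 §5/§5.1 (Route δ, recorded by the owner as the cell's candidate proof-route deviation for class (c),
HOME/GAPS.md «G-B3-16 ADDENDUM 1», owner note l.2887).  LOCATED MEMBER FILE — no head claim.  Inputs BY NAME: p40 g77's engine
`B3Op116CollarRows.{Far, top, farF, collarC, collar_row_le}` and support file `B3Op116CollarSources.{collB, NearSupp, norm_propagatorK_srcV_apply_collar_le,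
norm_covDeriv_map_srcV_collar_le, norm_mapE_avgSrc_near_le}`, r14's `B3Op116SourceForm.{srcV, op116_succ_left_apply, op116_succ_right_apply,
op116_zero_zero_apply, norm_propagatorK_dip_apply_le}`, p40's `B3Eq116TwoSidedExpansion.op116`, p35's `B3Op116MajorantStep.maj`.

## What is printed

[B3] p. 414 [PDF 4] (verbatim): *"the last term of this expansion, equal to [G_k(Ω, B)V_k(A, B)]^n G_k(Ω, A + B) [V_k(A, B)G_k(Ω, B)]^{n′},
(1.16) … a kernel of the operator (1.16) is a sufficiently regular function of both variables … exponentially decaying with the distance of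
the arguments"*; p. 426 (2.10): the per-piece propagator bounds, *"for each differentiation … an additional factor (L^jη)^{−1}"*; p. 433
[PDF 23] (class (c)): *"We have B̃ = B̃₀ + B̃′, and we expand in B̃′ … (I.3.44) … we include the operators (1.16) … into the external fields"* on
the cube `□`.  The cell's recorded route applies (I.3.44) ONCE to the collar part `P` of `B̃′` (`G_k(□,Y+P) − G_k(□,Y) = G_k(□,Y)V_k(P,Y)G_k(□,Y+P)`,
`B3Eq116TwoSidedExpansion.eq344_model`), whose support lies at lattice distance `≥ ρL^k` from the localization points; this file bounds the
kernel entries of that ONE-`V_k` operator — the `n + n′ = 1` case of (1.16), which has NO uniform bound for near arguments in `d = 3`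
(G-B3-15: exponent sum `3 = d`), but is uniformly bounded AND exponentially small in `ρ` for far-supported `P` (long legs, `maj_far_le_top`).

## What this file proves (rows at a pair of sites `x, x′` far from `supp P`; dictionary and support facts as hypotheses)

§1 `value_row_collar_le`: for every region `Ω`, backgrounds `X` (outer propagator), `X′` (inner propagator), `Y` (derivatives), perturbation
`P` with `sup|P| ≤ s`, and sites `x, x′` such that every `k`-block met by `supp P` is far from `x` and from `x′`:
`Σ_{i′}‖(G_k(Ω,X)V_k^Ω(P,Y)G_k(Ω,X′)e_{(x′,i′)})(x)‖ ≤ top_k(farF·collarC, 3; δ/4)(x,x′)` given the value column of `G_X` from `x` (exponent 2),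
its `Y`-derivatives at the collar bonds (exponent 1), the value column of `G_{X′}` from `x′` (exponent 2) and its `Y`-derivatives at the collar
bonds (exponent 1), all in p35's `maj` currency — r14's symmetric row (`B3Op116CollarSources.norm_propagatorK_srcV_apply_collar_le`) summed over
the basis, the averaging sources over the near blocks, then the engine `collar_row_le` (`κ₁ = κ₅ = |e|s`, `κ₂ = κ_F = 0`, `κ₃ = (|e|s)²`,
`κ₄ = |a_k|(L^kε)^{−2}m(2+m)`).  §2 `value_row_op116_one_zero_le` / `value_row_op116_zero_one_le`: the two orders `(1,0)` (`X = Y`,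
`X′ = Y + P`) and `(0,1)` (`X = Y + P`, `X′ = Y`) of the operator (1.16).  §3 `deriv_row_collar_le`: the derivative-type rows (row derivative
`hDv`, weight `θ = 1`; mixed entry `hM`, weight `θ = ε^{−1}` and dipole test source) through the MIXED kernel (no Leibniz rearrangement), §4 their
four instances.  §5 `holder_row_zero_of_deriv_row`: at Hölder exponent `α = 0` the transported-difference binder `hH` of the assembly is two
derivative rows (triangle inequality; `U(Y(Γ))` an isometry) — so all eight binders of the collar operator AT `α = 0` follow from §1–§4.

## Honest scope

Row algebra + the engine only: the (2.10) dictionary entries of the two propagators on `Ω`, the `Y`- versus `(Y+P)`-derivative conversions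
and the vanishing of the columns off `Ω` are HYPOTHESES here (discharged on a cell-product box by p35 g21's `B3Op116BoxRows.colB_dcolB_le` and
p40 g77's `B3Op116CollarSources` §2 in the plug file); constants explicit (`collarC` at the displayed charges), not yet re-expressed in print's
running currency `e(L^kε)p(L^kε)`.  The genuine Hölder row (`α > 0`: Leibniz form + (d−1)-dimensional face sums) and the cellBox plug
(dictionary discharge, constants) are NOT in this file (v1.0); the (1.32)-norm assembly with `Good := Interior k K₀ Ω₂` is
`B3Ineq25Op116SmoothInner` (p40 g77).  The class-(c) use on `□` is a RECORDED ROUTE DEVIATION from p. 433 l.12–15 (print's one-piece expansion on `□` is the cell's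
located open gap G-B3-16.A1).  Theorems only: no `def`, no `def … : Prop`, no new named fact, no `sorry`; axioms standard.
-/

noncomputable section

open scoped BigOperators

namespace Literature.MathematicalPhysics.QuantumFieldTheory.Balaban1983to89.B3Op116CollarKernel

open HiggsLattice (ChargeData ScalarField covDeriv)
open HiggsCovariance (propagatorK E)
open HiggsAveraging (blockK blockIter)
open B1Eq230FluctCov (Ix cb)
open B3Ineq210MixedRegularTorus (onb dip)
open B3Eq116TwoSidedExpansion (op116)
open B3Op116SourceForm (srcV avgSrc op116_succ_left_apply op116_succ_right_apply op116_zero_zero_apply)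
open B3Op116MajorantStep (maj maj_nonneg)
open B3Op116CollarRows (Far top farF collarC collar_row_le)
open B3Op116CollarSources (NearSupp collB mem_collB norm_propagatorK_srcV_apply_collar_le norm_mapE_avgSrc_near_le avgM_nonneg)

variable {P : HiggsLattice.Params} {N : ℕ}

/-! ## §1 The value row of `G_k(Ω,X)V_k^Ω(P,Y)G_k(Ω,X′)` at far arguments -/

section ValueRow

open scoped Classical

variable (C : ChargeData N) (Ω : Finset (HiggsLattice.Site P 0)) (A Y X X' : HiggsLattice.VecField P 0) (msq a : ℝ) {k : ℕ}

/-- **THE VALUE ROW OF THE ONE-`V_k` COLLAR OPERATOR.**  Region `Ω ⊆ T_ε`, perturbation `A = P` with `sup_b|P_b| ≤ s`, derivative background `Y`,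
outer propagator `G_k(Ω,X)`, inner propagator `G_k(Ω,X′)` (`m²`, `a`, `k ≤ K` arbitrary), sites `x, x′`; `L ≥ 2`, `0 < δ ≤ 1`, `ρ ≥ 1`.
GIVEN, in p35's `maj` currency, the value column of `G_X` read at `x` (`Σ_i‖(G_Xe_{(y,i)})(x)‖ ≤ 𝔪_k(c_K,2;δ)(x,y)`, all `y`), the
`Y`-derivatives of the row `x` of `G_X` at the collar bonds (`≤ 𝔪_k(c_K^D,1;δ)(b₋,x)`), the column `x′` of `G_{X′}` (`Σ_{i′}‖(G_{X′}e_{(x′,i′)})(u)‖ ≤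
𝔪_k(c_v,2;δ)(u,x′)`, all `u`) and its `Y`-derivatives at the collar bonds (`≤ 𝔪_k(c_d,1;δ)(b₋,x′)`), and the FAR GEOMETRY (every site of a
`k`-block from which a bond of `supp P` starts is far from `x` and from `x′`), THEN
`Σ_{i′}‖(G_k(Ω,X)V_k^Ω(P,Y)G_k(Ω,X′)e_{(x′,i′)})(x)‖ ≤ top_k(farF(δ,ρ)·collarC_k(δ;2,1,2;c_K,c_K^D,c_v,c_d;|e|s,0,(|e|s)²,|e|s,0,|a_k|(L^kε)^{−2}m(2+m)), 3; δ/4)(x,x′)`,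
`m = |e|sεd(L^k−1)` — a single top-scale bump of exponent `3`, exponentially small in `ρ`, uniform in `k`.
[cite: Balaban1983Higgs3, (1.16) p.414, (2.10) p.426, p.433] [cite: Balaban1982Higgs1, (3.16) p.615, (3.44) p.619] -/
theorem value_row_collar_le (hL2 : 2 ≤ P.L) (hkK : k ≤ P.K) {δ ρ : ℝ} (hδ : 0 < δ) (hδ1 : δ ≤ 1) (hρ : 1 ≤ ρ)
    {s cK cKd cv cd : ℝ} (hs : 0 ≤ s) (hcK : 0 ≤ cK) (hcKd : 0 ≤ cKd) (hcv : 0 ≤ cv) (hcd : 0 ≤ cd)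
    (hA : ∀ b : HiggsLattice.PBond P 0, |A b| ≤ s) (i₀ : Ix N) (x x' : HiggsLattice.Site P 0)
    (hK : ∀ y, ∑ i : Ix N, ‖propagatorK C Ω X msq a k (cb P N 0 (y, i)) x‖ ≤ maj P k cK 2 δ x y)
    (hKd : ∀ b ∈ collB Ω A, ∑ i : Ix N, ‖covDeriv C Y (propagatorK C Ω X msq a k (cb P N 0 (x, i))) b‖ ≤ maj P k cKd 1 δ b.src x)
    (hV : ∀ u, ∑ i' : Ix N, ‖propagatorK C Ω X' msq a k (cb P N 0 (x', i')) u‖ ≤ maj P k cv 2 δ u x')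
    (hD : ∀ b ∈ collB Ω A, ∑ i' : Ix N, ‖covDeriv C Y (propagatorK C Ω X' msq a k (cb P N 0 (x', i'))) b‖ ≤ maj P k cd 1 δ b.src x')
    (hfar : ∀ b : HiggsLattice.PBond P 0, A b ≠ 0 → ∀ z : HiggsLattice.Site P 0, blockIter k z = blockIter k b.src →
      Far P k ρ x z ∧ Far P k ρ z x') :
    ∑ i' : Ix N, ‖propagatorK C Ω X msq a k (srcV C A Y k Ω a (propagatorK C Ω X' msq a k (cb P N 0 (x', i')))) x‖
      ≤ top P k (farF P δ ρ * collarC P N k δ 2 1 2 cK cKd cv cd (|C.e| * s) 0 ((|C.e| * s) ^ 2) (|C.e| * s) 0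
            (|B1.aSeq a P.L k| * (P.mesh k)⁻¹ ^ 2 *
              ((|C.e| * s * P.mesh 0 * (P.d * ((P.L : ℝ) ^ k - 1))) * (2 + |C.e| * s * P.mesh 0 * (P.d * ((P.L : ℝ) ^ k - 1))))))
          3 (δ / 4) x x' := by
  -- abbreviations
  set w : Ix N → ScalarField P 0 N := fun i' => propagatorK C Ω X' msq a k (cb P N 0 (x', i')) with hw
  set K : HiggsLattice.Site P 0 → ℝ := fun y => ∑ i : Ix N, ‖propagatorK C Ω X msq a k (cb P N 0 (y, i)) x‖ with hKdef
  set Kd : HiggsLattice.PBond P 0 → ℝ := fun b => ∑ i : Ix N, ‖covDeriv C Y (propagatorK C Ω X msq a k (cb P N 0 (x, i))) b‖ with hKddef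
  set V : HiggsLattice.Site P 0 → ℝ := fun u => ∑ i' : Ix N, ‖w i' u‖ with hVdef
  set D : HiggsLattice.PBond P 0 → ℝ := fun b => ∑ i' : Ix N, ‖covDeriv C Y (w i') b‖ with hDdef
  set m : ℝ := |C.e| * s * P.mesh 0 * (P.d * ((P.L : ℝ) ^ k - 1)) with hm
  set κ₄ : ℝ := |B1.aSeq a P.L k| * (P.mesh k)⁻¹ ^ 2 * (m * (2 + m)) with hκ₄
  set S : Finset (HiggsLattice.PBond P 0) := collB Ω A with hS
  set Sz : Finset (HiggsLattice.Site P 0) := Finset.univ.filter (fun y : HiggsLattice.Site P 0 => NearSupp k A y) with hSz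
  have hes : 0 ≤ |C.e| * s := mul_nonneg (abs_nonneg _) hs
  have hm0 : 0 ≤ m := avgM_nonneg C k hs
  have hκ₄0 : 0 ≤ κ₄ := by rw [hκ₄]; positivity
  have hL0 : (0 : ℝ) ≤ (P.L : ℝ) := Nat.cast_nonneg _
  have hK0 : ∀ y, 0 ≤ K y := fun y => Finset.sum_nonneg fun _ _ => norm_nonneg _
  have hKd0 : ∀ b, 0 ≤ Kd b := fun b => Finset.sum_nonneg fun _ _ => norm_nonneg _
  have hV0 : ∀ u, 0 ≤ V u := fun u => Finset.sum_nonneg fun _ _ => norm_nonneg _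
  have hD0 : ∀ b, 0 ≤ D b := fun b => Finset.sum_nonneg fun _ _ => norm_nonneg _
  -- step 1: the symmetric row, per basis vector, with the averaging sources over the near blocks
  have hrow : ∀ i' : Ix N, ‖propagatorK C Ω X msq a k (srcV C A Y k Ω a (w i')) x‖
      ≤ (∑ b ∈ S, (|C.e| * s * ‖covDeriv C Y (w i') b‖ * K b.tgt + |C.e| * s * ‖w i' b.tgt‖ * Kd b
          + (|C.e| * s) ^ 2 * ‖w i' b.tgt‖ * K b.tgt))
        + κ₄ * ∑ z ∈ Sz, K z * (((P.L : ℝ) ^ (k * P.d))⁻¹ * ∑ u ∈ blockK k (blockIter k z), ‖w i' u‖) := by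
    intro i'
    have h1 := norm_propagatorK_srcV_apply_collar_le C Ω A Y a k X msq hA (w i') x
    have h2 := norm_mapE_avgSrc_near_le C A Y (k := k) ((LinearMap.proj x : ScalarField P 0 N →ₗ[ℝ] E N) ∘ₗ
      (propagatorK C Ω X msq a k : ScalarField P 0 N →ₗ[ℝ] ScalarField P 0 N)) hkK hs hA (w i')
    simp only [LinearMap.coe_comp, Function.comp_apply, LinearMap.proj_apply] at h2
    refine h1.trans (add_le_add (le_of_eq ?_) ?_)
    · rfl
    · rw [hκ₄, hSz]
      have hc : 0 ≤ |B1.aSeq a P.L k| * (P.mesh k)⁻¹ ^ 2 := by positivity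
      calc |B1.aSeq a P.L k| * (P.mesh k)⁻¹ ^ 2 * ‖propagatorK C Ω X msq a k (avgSrc C A Y k (w i')) x‖
          ≤ |B1.aSeq a P.L k| * (P.mesh k)⁻¹ ^ 2 *
              ∑ y ∈ Finset.univ.filter (fun y : HiggsLattice.Site P 0 => NearSupp k A y),
                (m * (2 + m) * (((P.L : ℝ) ^ (k * P.d))⁻¹ * ∑ u ∈ blockK k (blockIter k y), ‖w i' u‖)) * K y :=
            mul_le_mul_of_nonneg_left h2 hc
        _ = _ := by
            rw [mul_assoc (|B1.aSeq a P.L k| * (P.mesh k)⁻¹ ^ 2) (m * (2 + m)), Finset.mul_sum, Finset.mul_sum, Finset.mul_sum]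
            exact Finset.sum_congr rfl fun y _ => by ring
  -- step 2: sum over the basis and exchange the sums
  have hsum : ∑ i' : Ix N, ‖propagatorK C Ω X msq a k (srcV C A Y k Ω a (w i')) x‖
      ≤ (∑ b ∈ S, (|C.e| * s * D b * K b.tgt + |C.e| * s * V b.tgt * Kd b + (|C.e| * s) ^ 2 * V b.tgt * K b.tgt))
        + κ₄ * ∑ z ∈ Sz, K z * (((P.L : ℝ) ^ (k * P.d))⁻¹ * ∑ u ∈ blockK k (blockIter k z), V u) := by
    refine (Finset.sum_le_sum fun i' _ => hrow i').trans (le_of_eq ?_)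
    rw [Finset.sum_add_distrib]
    have hb : ∑ i' : Ix N, ∑ b ∈ S, (|C.e| * s * ‖covDeriv C Y (w i') b‖ * K b.tgt + |C.e| * s * ‖w i' b.tgt‖ * Kd b
          + (|C.e| * s) ^ 2 * ‖w i' b.tgt‖ * K b.tgt)
        = ∑ b ∈ S, (|C.e| * s * D b * K b.tgt + |C.e| * s * V b.tgt * Kd b + (|C.e| * s) ^ 2 * V b.tgt * K b.tgt) := by
      rw [Finset.sum_comm]
      refine Finset.sum_congr rfl fun b _ => ?_
      simp only [hDdef, hVdef, Finset.sum_add_distrib, ← Finset.sum_mul, ← Finset.mul_sum]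
    have hz : ∑ i' : Ix N, κ₄ * ∑ z ∈ Sz, K z * (((P.L : ℝ) ^ (k * P.d))⁻¹ * ∑ u ∈ blockK k (blockIter k z), ‖w i' u‖)
        = κ₄ * ∑ z ∈ Sz, K z * (((P.L : ℝ) ^ (k * P.d))⁻¹ * ∑ u ∈ blockK k (blockIter k z), V u) := by
      rw [← Finset.mul_sum, Finset.sum_comm]
      congr 1
      refine Finset.sum_congr rfl fun z _ => ?_
      rw [← Finset.mul_sum, ← Finset.mul_sum, Finset.sum_comm]
    rw [hb, hz]
  -- step 3: dominate by the engine's row shape (the extra term `κ₁D(b)K(b₋)` is nonnegative; no Leibniz value charge, no face term)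
  have hdom : (∑ b ∈ S, (|C.e| * s * D b * K b.tgt + |C.e| * s * V b.tgt * Kd b + (|C.e| * s) ^ 2 * V b.tgt * K b.tgt))
        + κ₄ * ∑ z ∈ Sz, K z * (((P.L : ℝ) ^ (k * P.d))⁻¹ * ∑ u ∈ blockK k (blockIter k z), V u)
      ≤ (∑ b ∈ S, (|C.e| * s * D b * K b.tgt + (0 * V b.src + |C.e| * s * D b) * K b.src + (|C.e| * s) ^ 2 * V b.tgt * K b.tgt
          + |C.e| * s * V b.tgt * Kd b))
        + 0 * ∑ y ∈ (∅ : Finset (HiggsLattice.Site P 0)), V y * K y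
        + κ₄ * ∑ z ∈ Sz, K z * (((P.L : ℝ) ^ (k * P.d))⁻¹ * ∑ u ∈ blockK k (blockIter k z), V u) := by
    rw [zero_mul, add_zero]
    refine add_le_add (Finset.sum_le_sum fun b _ => ?_) le_rfl
    have : 0 ≤ |C.e| * s * D b * K b.src := mul_nonneg (mul_nonneg hes (hD0 b)) (hK0 _)
    nlinarith
  -- step 4: the far geometry of the two source sets
  have hSfar : ∀ b ∈ S, Far P k ρ x b.src ∧ Far P k ρ b.src x' := fun b hb =>
    hfar b (mem_collB.1 hb).2 b.src rfl
  have hSzfar : ∀ z ∈ Sz, Far P k ρ x z := by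
    intro z hz
    rw [hSz, Finset.mem_filter] at hz
    obtain ⟨b, hb, hbz⟩ := hz.2
    exact (hfar b hb z hbz.symm).1
  -- step 5: the engine
  have hKdS : ∀ b ∈ S, Kd b ≤ maj P k cKd 1 δ b.src x := fun b hb => hKd b hb
  have hDS : ∀ b ∈ S, D b ≤ maj P k cd (2 - 1) δ b.src x' := fun b hb => by
    rw [show (2 : ℝ) - 1 = 1 by norm_num]; exact hD b hb
  have heng := collar_row_le (N := N) hL2 hkK hδ hδ1 hρ (aK := 2) (aKd := 1) (av := 2) (by norm_num) (by norm_num) (by norm_num)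
    hcK hcKd hcv hcd hes le_rfl (pow_nonneg hes 2) hes le_rfl hκ₄0 i₀ x x' S ∅ Sz K hK0 hK Kd hKd0 hKdS V hV0 hV D hD0 hDS
    hSfar (fun y hy => absurd hy (Finset.notMem_empty y)) hSzfar
  rw [show (2 : ℝ) + 2 - 1 = 3 by norm_num] at heng
  exact hsum.trans (hdom.trans heng)

/-! ## §2 The two orders `(1,0)` and `(0,1)` of the operator (1.16) -/

/-- **THE VALUE ROW OF `(1.16)_{1,0} = G_k(Ω,Y)V_k(P,Y)G_k(Ω,Y+P)`** at far arguments: `value_row_collar_le` with `X = Y`, `X′ = P + Y`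
(`op116_succ_left_apply`, `op116_zero_zero_apply`). [cite: Balaban1983Higgs3, (1.16) p.414, (2.10) p.426, p.433] [cite: Balaban1982Higgs1, (3.44) p.619] -/
theorem value_row_op116_one_zero_le (hL2 : 2 ≤ P.L) (hkK : k ≤ P.K) {δ ρ : ℝ} (hδ : 0 < δ) (hδ1 : δ ≤ 1) (hρ : 1 ≤ ρ)
    {s cK cKd cv cd : ℝ} (hs : 0 ≤ s) (hcK : 0 ≤ cK) (hcKd : 0 ≤ cKd) (hcv : 0 ≤ cv) (hcd : 0 ≤ cd)
    (hA : ∀ b : HiggsLattice.PBond P 0, |A b| ≤ s) (i₀ : Ix N) (x x' : HiggsLattice.Site P 0)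
    (hK : ∀ y, ∑ i : Ix N, ‖propagatorK C Ω Y msq a k (cb P N 0 (y, i)) x‖ ≤ maj P k cK 2 δ x y)
    (hKd : ∀ b ∈ collB Ω A, ∑ i : Ix N, ‖covDeriv C Y (propagatorK C Ω Y msq a k (cb P N 0 (x, i))) b‖ ≤ maj P k cKd 1 δ b.src x)
    (hV : ∀ u, ∑ i' : Ix N, ‖propagatorK C Ω (A + Y) msq a k (cb P N 0 (x', i')) u‖ ≤ maj P k cv 2 δ u x')
    (hD : ∀ b ∈ collB Ω A, ∑ i' : Ix N, ‖covDeriv C Y (propagatorK C Ω (A + Y) msq a k (cb P N 0 (x', i'))) b‖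
      ≤ maj P k cd 1 δ b.src x')
    (hfar : ∀ b : HiggsLattice.PBond P 0, A b ≠ 0 → ∀ z : HiggsLattice.Site P 0, blockIter k z = blockIter k b.src →
      Far P k ρ x z ∧ Far P k ρ z x') :
    ∑ i' : Ix N, ‖op116 C Ω A Y msq a k 1 0 (cb P N 0 (x', i')) x‖
      ≤ top P k (farF P δ ρ * collarC P N k δ 2 1 2 cK cKd cv cd (|C.e| * s) 0 ((|C.e| * s) ^ 2) (|C.e| * s) 0
            (|B1.aSeq a P.L k| * (P.mesh k)⁻¹ ^ 2 *
              ((|C.e| * s * P.mesh 0 * (P.d * ((P.L : ℝ) ^ k - 1))) * (2 + |C.e| * s * P.mesh 0 * (P.d * ((P.L : ℝ) ^ k - 1))))))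
          3 (δ / 4) x x' := by
  have h := value_row_collar_le C Ω A Y Y (A + Y) msq a hL2 hkK hδ hδ1 hρ hs hcK hcKd hcv hcd hA i₀ x x' hK hKd hV hD hfar
  refine le_trans (le_of_eq (Finset.sum_congr rfl fun i' _ => ?_)) h
  rw [op116_succ_left_apply, op116_zero_zero_apply]

/-- **THE VALUE ROW OF `(1.16)_{0,1} = G_k(Ω,Y+P)V_k(P,Y)G_k(Ω,Y)`** at far arguments: `value_row_collar_le` with `X = P + Y`, `X′ = Y`
(`op116_succ_right_apply`, `op116_zero_zero_apply`). [cite: Balaban1983Higgs3, (1.16) p.414, (2.10) p.426, p.433] [cite: Balaban1982Higgs1, (3.44) p.619] -/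
theorem value_row_op116_zero_one_le (hL2 : 2 ≤ P.L) (hkK : k ≤ P.K) {δ ρ : ℝ} (hδ : 0 < δ) (hδ1 : δ ≤ 1) (hρ : 1 ≤ ρ)
    {s cK cKd cv cd : ℝ} (hs : 0 ≤ s) (hcK : 0 ≤ cK) (hcKd : 0 ≤ cKd) (hcv : 0 ≤ cv) (hcd : 0 ≤ cd)
    (hA : ∀ b : HiggsLattice.PBond P 0, |A b| ≤ s) (i₀ : Ix N) (x x' : HiggsLattice.Site P 0)
    (hK : ∀ y, ∑ i : Ix N, ‖propagatorK C Ω (A + Y) msq a k (cb P N 0 (y, i)) x‖ ≤ maj P k cK 2 δ x y)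
    (hKd : ∀ b ∈ collB Ω A, ∑ i : Ix N, ‖covDeriv C Y (propagatorK C Ω (A + Y) msq a k (cb P N 0 (x, i))) b‖
      ≤ maj P k cKd 1 δ b.src x)
    (hV : ∀ u, ∑ i' : Ix N, ‖propagatorK C Ω Y msq a k (cb P N 0 (x', i')) u‖ ≤ maj P k cv 2 δ u x')
    (hD : ∀ b ∈ collB Ω A, ∑ i' : Ix N, ‖covDeriv C Y (propagatorK C Ω Y msq a k (cb P N 0 (x', i'))) b‖ ≤ maj P k cd 1 δ b.src x')
    (hfar : ∀ b : HiggsLattice.PBond P 0, A b ≠ 0 → ∀ z : HiggsLattice.Site P 0, blockIter k z = blockIter k b.src →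
      Far P k ρ x z ∧ Far P k ρ z x') :
    ∑ i' : Ix N, ‖op116 C Ω A Y msq a k 0 1 (cb P N 0 (x', i')) x‖
      ≤ top P k (farF P δ ρ * collarC P N k δ 2 1 2 cK cKd cv cd (|C.e| * s) 0 ((|C.e| * s) ^ 2) (|C.e| * s) 0
            (|B1.aSeq a P.L k| * (P.mesh k)⁻¹ ^ 2 *
              ((|C.e| * s * P.mesh 0 * (P.d * ((P.L : ℝ) ^ k - 1))) * (2 + |C.e| * s * P.mesh 0 * (P.d * ((P.L : ℝ) ^ k - 1))))))
          3 (δ / 4) x x' := by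
  have h := value_row_collar_le C Ω A Y (A + Y) Y msq a hL2 hkK hδ hδ1 hρ hs hcK hcKd hcv hcd hA i₀ x x' hK hKd hV hD hfar
  refine le_trans (le_of_eq (Finset.sum_congr rfl fun i' _ => ?_)) h
  rw [op116_succ_right_apply, op116_zero_zero_apply]

end ValueRow

/-! ## §3 The derivative-type rows of `G_k(Ω,X)V_k^Ω(P,Y)w` at far arguments: the row derivative and the mixed entry -/

section DerivRow

open scoped Classical

variable (C : ChargeData N) (Ω : Finset (HiggsLattice.Site P 0)) (A Y X : HiggsLattice.VecField P 0) (msq a : ℝ) {k : ℕ}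

/-- **THE DERIVATIVE-TYPE ROW OF THE ONE-`V_k` COLLAR OPERATOR** (serves the row-derivative entry `hDv` AND the mixed entry `hM` of the cell's
(1.32)-norm assembly `B3Ineq25Op116Smooth.ineq25At_op116_smooth_of_bounds`).  Region `Ω`, perturbation `A = P` (`sup|P| ≤ s`), derivative background
`Y`, outer propagator `G_k(Ω,X)`, a bond `b₀`, a test site `x′`, a finite family of states `w_{i′}` with a weight `θ ≥ 0` (`θ = 1`, `w_{i′} =
G_k(Ω,X′)e_{(x′,i′)}`, `a_v = 2` for `hDv`; `θ = ε^{−1}`, `w_i = G_k(Ω,X′)dip_{⟨x′,ν⟩}e_i`, `a_v = 1` for `hM`).  GIVEN the differentiated column of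
`G_X` read at `b₀` (`Σ_i‖(D^ε_YG_Xe_{(y,i)})(b₀)‖ ≤ 𝔪_k(c_K,1;δ)(b₀₋,y)`), the twice-differentiated (mixed) entries at the collar bonds
(`ε^{−1}Σ_i‖(D^ε_YG_Xdip_be_i)(b₀)‖ ≤ 𝔪_k(c_K^D,0;δ)(b₋,b₀₋)`), the weighted values `θΣ_{i′}‖w_{i′}(u)‖ ≤ 𝔪_k(c_v,a_v;δ)(u,x′)` (all `u`, `a_v ≥ 1`)
and weighted `Y`-derivatives at the collar bonds (`≤ 𝔪_k(c_d,a_v−1;δ)(b₋,x′)`), and the far geometry from `b₀₋` and from `x′`, THEN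
`θ·Σ_{i′}‖(D^ε_YG_k(Ω,X)V_k^Ω(P,Y)w_{i′})(b₀)‖ ≤ top_k(farF·collarC_k(δ;1,0,a_v;…;|e|s,0,(|e|s)²,|e|s,0,κ₄), a_v; δ/4)(b₀₋,x′)` — r14's derivative
row (`B3Op116CollarSources.norm_covDeriv_map_srcV_collar_le`, the dipole entry through the MIXED kernel: no Leibniz rearrangement, no face term)
+ the engine `collar_row_le` with `a_K = 1`, `a^D = 0`. [cite: Balaban1983Higgs3, (1.16) p.414, (2.10) p.426, p.433] [cite: Balaban1982Higgs1, (3.16) p.615] -/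
theorem deriv_row_collar_le (hL2 : 2 ≤ P.L) (hkK : k ≤ P.K) {δ ρ : ℝ} (hδ : 0 < δ) (hδ1 : δ ≤ 1) (hρ : 1 ≤ ρ)
    {s cK cKd cv cd av θ : ℝ} (hs : 0 ≤ s) (hcK : 0 ≤ cK) (hcKd : 0 ≤ cKd) (hcv : 0 ≤ cv) (hcd : 0 ≤ cd) (hav : 1 ≤ av) (hθ : 0 ≤ θ)
    (hA : ∀ b : HiggsLattice.PBond P 0, |A b| ≤ s) (i₀ : Ix N) (b₀ : HiggsLattice.PBond P 0) (x' : HiggsLattice.Site P 0)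
    (w : Ix N → ScalarField P 0 N)
    (hK : ∀ y, ∑ i : Ix N, ‖covDeriv C Y (propagatorK C Ω X msq a k (cb P N 0 (y, i))) b₀‖ ≤ maj P k cK 1 δ b₀.src y)
    (hKd : ∀ b ∈ collB Ω A, (P.mesh 0)⁻¹ * ∑ i : Ix N, ‖covDeriv C Y (propagatorK C Ω X msq a k (dip C Y b (onb N i))) b₀‖
      ≤ maj P k cKd 0 δ b.src b₀.src)
    (hV : ∀ u, θ * ∑ i' : Ix N, ‖w i' u‖ ≤ maj P k cv av δ u x')
    (hD : ∀ b ∈ collB Ω A, θ * ∑ i' : Ix N, ‖covDeriv C Y (w i') b‖ ≤ maj P k cd (av - 1) δ b.src x')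
    (hfar : ∀ b : HiggsLattice.PBond P 0, A b ≠ 0 → ∀ z : HiggsLattice.Site P 0, blockIter k z = blockIter k b.src →
      Far P k ρ b₀.src z ∧ Far P k ρ z x') :
    θ * ∑ i' : Ix N, ‖covDeriv C Y (propagatorK C Ω X msq a k (srcV C A Y k Ω a (w i'))) b₀‖
      ≤ top P k (farF P δ ρ * collarC P N k δ 1 0 av cK cKd cv cd (|C.e| * s) 0 ((|C.e| * s) ^ 2) (|C.e| * s) 0
            (|B1.aSeq a P.L k| * (P.mesh k)⁻¹ ^ 2 *
              ((|C.e| * s * P.mesh 0 * (P.d * ((P.L : ℝ) ^ k - 1))) * (2 + |C.e| * s * P.mesh 0 * (P.d * ((P.L : ℝ) ^ k - 1))))))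
          av (δ / 4) b₀.src x' := by
  -- abbreviations
  set K : HiggsLattice.Site P 0 → ℝ := fun y => ∑ i : Ix N, ‖covDeriv C Y (propagatorK C Ω X msq a k (cb P N 0 (y, i))) b₀‖ with hKdef
  set Kd : HiggsLattice.PBond P 0 → ℝ := fun b =>
    (P.mesh 0)⁻¹ * ∑ i : Ix N, ‖covDeriv C Y (propagatorK C Ω X msq a k (dip C Y b (onb N i))) b₀‖ with hKddef
  set V : HiggsLattice.Site P 0 → ℝ := fun u => θ * ∑ i' : Ix N, ‖w i' u‖ with hVdef
  set D : HiggsLattice.PBond P 0 → ℝ := fun b => θ * ∑ i' : Ix N, ‖covDeriv C Y (w i') b‖ with hDdef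
  set m : ℝ := |C.e| * s * P.mesh 0 * (P.d * ((P.L : ℝ) ^ k - 1)) with hm
  set κ₄ : ℝ := |B1.aSeq a P.L k| * (P.mesh k)⁻¹ ^ 2 * (m * (2 + m)) with hκ₄
  set S : Finset (HiggsLattice.PBond P 0) := collB Ω A with hS
  set Sz : Finset (HiggsLattice.Site P 0) := Finset.univ.filter (fun y : HiggsLattice.Site P 0 => NearSupp k A y) with hSz
  set T : ScalarField P 0 N →ₗ[ℝ] E N := B3Op116SourceForm.covDerivAt C Y b₀ ∘ₗ
    (propagatorK C Ω X msq a k : ScalarField P 0 N →ₗ[ℝ] ScalarField P 0 N) with hT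
  have hes : 0 ≤ |C.e| * s := mul_nonneg (abs_nonneg _) hs
  have hm0 : 0 ≤ m := avgM_nonneg C k hs
  have hκ₄0 : 0 ≤ κ₄ := by rw [hκ₄]; positivity
  have hε0 : 0 ≤ (P.mesh 0)⁻¹ := inv_nonneg.mpr (P.mesh_pos 0).le
  have hK0 : ∀ y, 0 ≤ K y := fun y => Finset.sum_nonneg fun _ _ => norm_nonneg _
  have hKd0 : ∀ b, 0 ≤ Kd b := fun b => mul_nonneg hε0 (Finset.sum_nonneg fun _ _ => norm_nonneg _)
  have hV0 : ∀ u, 0 ≤ V u := fun u => mul_nonneg hθ (Finset.sum_nonneg fun _ _ => norm_nonneg _)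
  have hD0 : ∀ b, 0 ≤ D b := fun b => mul_nonneg hθ (Finset.sum_nonneg fun _ _ => norm_nonneg _)
  -- step 1: the derivative row, per state, with the averaging sources over the near blocks
  have hrow : ∀ i' : Ix N, ‖covDeriv C Y (propagatorK C Ω X msq a k (srcV C A Y k Ω a (w i'))) b₀‖
      ≤ (∑ b ∈ S, (|C.e| * s * ‖covDeriv C Y (w i') b‖ * K b.tgt + |C.e| * s * ‖w i' b.tgt‖ * Kd b
          + (|C.e| * s) ^ 2 * ‖w i' b.tgt‖ * K b.tgt))
        + κ₄ * ∑ z ∈ Sz, K z * (((P.L : ℝ) ^ (k * P.d))⁻¹ * ∑ u ∈ blockK k (blockIter k z), ‖w i' u‖) := by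
    intro i'
    have h1 := B3Op116CollarSources.norm_covDeriv_map_srcV_collar_le C Ω A Y a k
      (propagatorK C Ω X msq a k : ScalarField P 0 N →ₗ[ℝ] ScalarField P 0 N) hA (w i') b₀
    have h2 := norm_mapE_avgSrc_near_le C A Y (k := k) T hkK hs hA (w i')
    simp only [hT, LinearMap.coe_comp, Function.comp_apply, B3Op116SourceForm.covDerivAt_apply] at h2
    refine h1.trans (add_le_add (le_of_eq (Finset.sum_congr rfl fun b _ => ?_)) ?_)
    · simp only [hKdef, hKddef]; ring
    · rw [hκ₄, hSz]
      have hc : 0 ≤ |B1.aSeq a P.L k| * (P.mesh k)⁻¹ ^ 2 := by positivity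
      calc |B1.aSeq a P.L k| * (P.mesh k)⁻¹ ^ 2 * ‖covDeriv C Y (propagatorK C Ω X msq a k (avgSrc C A Y k (w i'))) b₀‖
          ≤ |B1.aSeq a P.L k| * (P.mesh k)⁻¹ ^ 2 *
              ∑ y ∈ Finset.univ.filter (fun y : HiggsLattice.Site P 0 => NearSupp k A y),
                (m * (2 + m) * (((P.L : ℝ) ^ (k * P.d))⁻¹ * ∑ u ∈ blockK k (blockIter k y), ‖w i' u‖)) * K y :=
            mul_le_mul_of_nonneg_left h2 hc
        _ = _ := by
            rw [mul_assoc (|B1.aSeq a P.L k| * (P.mesh k)⁻¹ ^ 2) (m * (2 + m)), Finset.mul_sum, Finset.mul_sum, Finset.mul_sum]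
            exact Finset.sum_congr rfl fun y _ => by ring
  -- step 2: weight, sum over the family and exchange the sums
  have hsum : θ * ∑ i' : Ix N, ‖covDeriv C Y (propagatorK C Ω X msq a k (srcV C A Y k Ω a (w i'))) b₀‖
      ≤ (∑ b ∈ S, (|C.e| * s * D b * K b.tgt + |C.e| * s * V b.tgt * Kd b + (|C.e| * s) ^ 2 * V b.tgt * K b.tgt))
        + κ₄ * ∑ z ∈ Sz, K z * (((P.L : ℝ) ^ (k * P.d))⁻¹ * ∑ u ∈ blockK k (blockIter k z), V u) := by
    refine (mul_le_mul_of_nonneg_left (Finset.sum_le_sum fun i' _ => hrow i') hθ).trans (le_of_eq ?_)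
    rw [Finset.sum_add_distrib, mul_add]
    have hb : θ * ∑ i' : Ix N, ∑ b ∈ S, (|C.e| * s * ‖covDeriv C Y (w i') b‖ * K b.tgt + |C.e| * s * ‖w i' b.tgt‖ * Kd b
          + (|C.e| * s) ^ 2 * ‖w i' b.tgt‖ * K b.tgt)
        = ∑ b ∈ S, (|C.e| * s * D b * K b.tgt + |C.e| * s * V b.tgt * Kd b + (|C.e| * s) ^ 2 * V b.tgt * K b.tgt) := by
      rw [Finset.sum_comm, Finset.mul_sum]
      refine Finset.sum_congr rfl fun b _ => ?_
      simp only [hDdef, hVdef, Finset.sum_add_distrib, ← Finset.sum_mul, ← Finset.mul_sum]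
      ring
    have hz : θ * ∑ i' : Ix N, κ₄ * ∑ z ∈ Sz, K z * (((P.L : ℝ) ^ (k * P.d))⁻¹ * ∑ u ∈ blockK k (blockIter k z), ‖w i' u‖)
        = κ₄ * ∑ z ∈ Sz, K z * (((P.L : ℝ) ^ (k * P.d))⁻¹ * ∑ u ∈ blockK k (blockIter k z), V u) := by
      simp only [hVdef, Finset.mul_sum]
      conv_lhs => rw [Finset.sum_comm]
      refine Finset.sum_congr rfl fun z _ => ?_
      conv_lhs => rw [Finset.sum_comm]
      exact Finset.sum_congr rfl fun u _ => Finset.sum_congr rfl fun i' _ => by ring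
    rw [hb, hz]
  -- step 3: dominate by the engine's row shape
  have hdom : (∑ b ∈ S, (|C.e| * s * D b * K b.tgt + |C.e| * s * V b.tgt * Kd b + (|C.e| * s) ^ 2 * V b.tgt * K b.tgt))
        + κ₄ * ∑ z ∈ Sz, K z * (((P.L : ℝ) ^ (k * P.d))⁻¹ * ∑ u ∈ blockK k (blockIter k z), V u)
      ≤ (∑ b ∈ S, (|C.e| * s * D b * K b.tgt + (0 * V b.src + |C.e| * s * D b) * K b.src + (|C.e| * s) ^ 2 * V b.tgt * K b.tgt
          + |C.e| * s * V b.tgt * Kd b))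
        + 0 * ∑ y ∈ (∅ : Finset (HiggsLattice.Site P 0)), V y * K y
        + κ₄ * ∑ z ∈ Sz, K z * (((P.L : ℝ) ^ (k * P.d))⁻¹ * ∑ u ∈ blockK k (blockIter k z), V u) := by
    rw [zero_mul, add_zero]
    refine add_le_add (Finset.sum_le_sum fun b _ => ?_) le_rfl
    have : 0 ≤ |C.e| * s * D b * K b.src := mul_nonneg (mul_nonneg hes (hD0 b)) (hK0 _)
    nlinarith
  -- step 4: the far geometry of the two source sets
  have hSfar : ∀ b ∈ S, Far P k ρ b₀.src b.src ∧ Far P k ρ b.src x' := fun b hb =>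
    hfar b (mem_collB.1 hb).2 b.src rfl
  have hSzfar : ∀ z ∈ Sz, Far P k ρ b₀.src z := by
    intro z hz
    rw [hSz, Finset.mem_filter] at hz
    obtain ⟨b, hb, hbz⟩ := hz.2
    exact (hfar b hb z hbz.symm).1
  -- step 5: the engine
  have hKdS : ∀ b ∈ S, Kd b ≤ maj P k cKd 0 δ b.src b₀.src := fun b hb => hKd b hb
  have hDS : ∀ b ∈ S, D b ≤ maj P k cd (av - 1) δ b.src x' := fun b hb => hD b hb
  have heng := collar_row_le (N := N) hL2 hkK hδ hδ1 hρ (aK := 1) (aKd := 0) (av := av) (by norm_num) le_rfl hav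
    hcK hcKd hcv hcd hes le_rfl (pow_nonneg hes 2) hes le_rfl hκ₄0 i₀ b₀.src x' S ∅ Sz K hK0 hK Kd hKd0 hKdS V hV0 hV D hD0 hDS
    hSfar (fun y hy => absurd hy (Finset.notMem_empty y)) hSzfar
  rw [show (1 : ℝ) + av - 1 = av by ring] at heng
  exact hsum.trans (hdom.trans heng)

/-! ## §4 The four instances: row derivative and mixed entry of `(1.16)_{1,0}` and `(1.16)_{0,1}` -/

/-- **ROW DERIVATIVE OF `(1.16)_{1,0}`** at far arguments (`θ = 1`, states `G_k(Ω,P+Y)e_{(x′,i′)}`, `a_v = 2`; top exponent `2`).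
[cite: Balaban1983Higgs3, (1.16) p.414, (2.10) p.426, p.433] [cite: Balaban1982Higgs1, (3.44) p.619] -/
theorem deriv_row_op116_one_zero_le (hL2 : 2 ≤ P.L) (hkK : k ≤ P.K) {δ ρ : ℝ} (hδ : 0 < δ) (hδ1 : δ ≤ 1) (hρ : 1 ≤ ρ)
    {s cK cKd cv cd : ℝ} (hs : 0 ≤ s) (hcK : 0 ≤ cK) (hcKd : 0 ≤ cKd) (hcv : 0 ≤ cv) (hcd : 0 ≤ cd)
    (hA : ∀ b : HiggsLattice.PBond P 0, |A b| ≤ s) (i₀ : Ix N) (b₀ : HiggsLattice.PBond P 0) (x' : HiggsLattice.Site P 0)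
    (hK : ∀ y, ∑ i : Ix N, ‖covDeriv C Y (propagatorK C Ω Y msq a k (cb P N 0 (y, i))) b₀‖ ≤ maj P k cK 1 δ b₀.src y)
    (hKd : ∀ b ∈ collB Ω A, (P.mesh 0)⁻¹ * ∑ i : Ix N, ‖covDeriv C Y (propagatorK C Ω Y msq a k (dip C Y b (onb N i))) b₀‖
      ≤ maj P k cKd 0 δ b.src b₀.src)
    (hV : ∀ u, ∑ i' : Ix N, ‖propagatorK C Ω (A + Y) msq a k (cb P N 0 (x', i')) u‖ ≤ maj P k cv 2 δ u x')
    (hD : ∀ b ∈ collB Ω A, ∑ i' : Ix N, ‖covDeriv C Y (propagatorK C Ω (A + Y) msq a k (cb P N 0 (x', i'))) b‖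
      ≤ maj P k cd 1 δ b.src x')
    (hfar : ∀ b : HiggsLattice.PBond P 0, A b ≠ 0 → ∀ z : HiggsLattice.Site P 0, blockIter k z = blockIter k b.src →
      Far P k ρ b₀.src z ∧ Far P k ρ z x') :
    ∑ i' : Ix N, ‖covDeriv C Y (op116 C Ω A Y msq a k 1 0 (cb P N 0 (x', i'))) b₀‖
      ≤ top P k (farF P δ ρ * collarC P N k δ 1 0 2 cK cKd cv cd (|C.e| * s) 0 ((|C.e| * s) ^ 2) (|C.e| * s) 0
            (|B1.aSeq a P.L k| * (P.mesh k)⁻¹ ^ 2 *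
              ((|C.e| * s * P.mesh 0 * (P.d * ((P.L : ℝ) ^ k - 1))) * (2 + |C.e| * s * P.mesh 0 * (P.d * ((P.L : ℝ) ^ k - 1))))))
          2 (δ / 4) b₀.src x' := by
  have h := deriv_row_collar_le C Ω A Y Y msq a hL2 hkK hδ hδ1 hρ (av := 2) (θ := 1) hs hcK hcKd hcv hcd (by norm_num) zero_le_one
    hA i₀ b₀ x' (fun i' => propagatorK C Ω (A + Y) msq a k (cb P N 0 (x', i'))) hK hKd
    (fun u => by rw [one_mul]; exact hV u) (fun b hb => by rw [one_mul, show (2 : ℝ) - 1 = 1 by norm_num]; exact hD b hb) hfar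
  rw [one_mul] at h
  refine le_trans (le_of_eq (Finset.sum_congr rfl fun i' _ => ?_)) h
  rw [op116_succ_left_apply, op116_zero_zero_apply]

/-- **ROW DERIVATIVE OF `(1.16)_{0,1}`** at far arguments (`θ = 1`, states `G_k(Ω,Y)e_{(x′,i′)}`, `a_v = 2`; top exponent `2`).
[cite: Balaban1983Higgs3, (1.16) p.414, (2.10) p.426, p.433] [cite: Balaban1982Higgs1, (3.44) p.619] -/
theorem deriv_row_op116_zero_one_le (hL2 : 2 ≤ P.L) (hkK : k ≤ P.K) {δ ρ : ℝ} (hδ : 0 < δ) (hδ1 : δ ≤ 1) (hρ : 1 ≤ ρ)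
    {s cK cKd cv cd : ℝ} (hs : 0 ≤ s) (hcK : 0 ≤ cK) (hcKd : 0 ≤ cKd) (hcv : 0 ≤ cv) (hcd : 0 ≤ cd)
    (hA : ∀ b : HiggsLattice.PBond P 0, |A b| ≤ s) (i₀ : Ix N) (b₀ : HiggsLattice.PBond P 0) (x' : HiggsLattice.Site P 0)
    (hK : ∀ y, ∑ i : Ix N, ‖covDeriv C Y (propagatorK C Ω (A + Y) msq a k (cb P N 0 (y, i))) b₀‖ ≤ maj P k cK 1 δ b₀.src y)
    (hKd : ∀ b ∈ collB Ω A, (P.mesh 0)⁻¹ * ∑ i : Ix N, ‖covDeriv C Y (propagatorK C Ω (A + Y) msq a k (dip C Y b (onb N i))) b₀‖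
      ≤ maj P k cKd 0 δ b.src b₀.src)
    (hV : ∀ u, ∑ i' : Ix N, ‖propagatorK C Ω Y msq a k (cb P N 0 (x', i')) u‖ ≤ maj P k cv 2 δ u x')
    (hD : ∀ b ∈ collB Ω A, ∑ i' : Ix N, ‖covDeriv C Y (propagatorK C Ω Y msq a k (cb P N 0 (x', i'))) b‖ ≤ maj P k cd 1 δ b.src x')
    (hfar : ∀ b : HiggsLattice.PBond P 0, A b ≠ 0 → ∀ z : HiggsLattice.Site P 0, blockIter k z = blockIter k b.src →
      Far P k ρ b₀.src z ∧ Far P k ρ z x') :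
    ∑ i' : Ix N, ‖covDeriv C Y (op116 C Ω A Y msq a k 0 1 (cb P N 0 (x', i'))) b₀‖
      ≤ top P k (farF P δ ρ * collarC P N k δ 1 0 2 cK cKd cv cd (|C.e| * s) 0 ((|C.e| * s) ^ 2) (|C.e| * s) 0
            (|B1.aSeq a P.L k| * (P.mesh k)⁻¹ ^ 2 *
              ((|C.e| * s * P.mesh 0 * (P.d * ((P.L : ℝ) ^ k - 1))) * (2 + |C.e| * s * P.mesh 0 * (P.d * ((P.L : ℝ) ^ k - 1))))))
          2 (δ / 4) b₀.src x' := by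
  have h := deriv_row_collar_le C Ω A Y (A + Y) msq a hL2 hkK hδ hδ1 hρ (av := 2) (θ := 1) hs hcK hcKd hcv hcd (by norm_num)
    zero_le_one hA i₀ b₀ x' (fun i' => propagatorK C Ω Y msq a k (cb P N 0 (x', i'))) hK hKd
    (fun u => by rw [one_mul]; exact hV u) (fun b hb => by rw [one_mul, show (2 : ℝ) - 1 = 1 by norm_num]; exact hD b hb) hfar
  rw [one_mul] at h
  refine le_trans (le_of_eq (Finset.sum_congr rfl fun i' _ => ?_)) h
  rw [op116_succ_right_apply, op116_zero_zero_apply]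

/-- **MIXED ENTRY OF `(1.16)_{1,0}`** at far arguments (`θ = ε^{−1}`, states `G_k(Ω,P+Y)dip_{⟨x′,ν⟩}e_i`, `a_v = 1`; top exponent `1`): the dipole test
source makes the states' values a differentiated column (r14's `norm_propagatorK_dip_apply_le`, supplied as `hV`) and their derivatives a mixed entry
(`hD`). [cite: Balaban1983Higgs3, (1.16) p.414, (2.10) p.426, p.433] [cite: Balaban1982Higgs1, (1.7) p.605, (3.44) p.619] -/
theorem mixed_row_op116_one_zero_le (hL2 : 2 ≤ P.L) (hkK : k ≤ P.K) {δ ρ : ℝ} (hδ : 0 < δ) (hδ1 : δ ≤ 1) (hρ : 1 ≤ ρ)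
    {s cK cKd cv cd : ℝ} (hs : 0 ≤ s) (hcK : 0 ≤ cK) (hcKd : 0 ≤ cKd) (hcv : 0 ≤ cv) (hcd : 0 ≤ cd)
    (hA : ∀ b : HiggsLattice.PBond P 0, |A b| ≤ s) (i₀ : Ix N) (b₀ c : HiggsLattice.PBond P 0)
    (hK : ∀ y, ∑ i : Ix N, ‖covDeriv C Y (propagatorK C Ω Y msq a k (cb P N 0 (y, i))) b₀‖ ≤ maj P k cK 1 δ b₀.src y)
    (hKd : ∀ b ∈ collB Ω A, (P.mesh 0)⁻¹ * ∑ i : Ix N, ‖covDeriv C Y (propagatorK C Ω Y msq a k (dip C Y b (onb N i))) b₀‖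
      ≤ maj P k cKd 0 δ b.src b₀.src)
    (hV : ∀ u, (P.mesh 0)⁻¹ * ∑ i : Ix N, ‖propagatorK C Ω (A + Y) msq a k (dip C Y c (onb N i)) u‖ ≤ maj P k cv 1 δ u c.src)
    (hD : ∀ b ∈ collB Ω A, (P.mesh 0)⁻¹ * ∑ i : Ix N, ‖covDeriv C Y (propagatorK C Ω (A + Y) msq a k (dip C Y c (onb N i))) b‖
      ≤ maj P k cd 0 δ b.src c.src)
    (hfar : ∀ b : HiggsLattice.PBond P 0, A b ≠ 0 → ∀ z : HiggsLattice.Site P 0, blockIter k z = blockIter k b.src →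
      Far P k ρ b₀.src z ∧ Far P k ρ z c.src) :
    (P.mesh 0)⁻¹ * ∑ i : Ix N, ‖covDeriv C Y (op116 C Ω A Y msq a k 1 0 (dip C Y c (onb N i))) b₀‖
      ≤ top P k (farF P δ ρ * collarC P N k δ 1 0 1 cK cKd cv cd (|C.e| * s) 0 ((|C.e| * s) ^ 2) (|C.e| * s) 0
            (|B1.aSeq a P.L k| * (P.mesh k)⁻¹ ^ 2 *
              ((|C.e| * s * P.mesh 0 * (P.d * ((P.L : ℝ) ^ k - 1))) * (2 + |C.e| * s * P.mesh 0 * (P.d * ((P.L : ℝ) ^ k - 1))))))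
          1 (δ / 4) b₀.src c.src := by
  have h := deriv_row_collar_le C Ω A Y Y msq a hL2 hkK hδ hδ1 hρ (av := 1) (θ := (P.mesh 0)⁻¹) hs hcK hcKd hcv hcd le_rfl
    (inv_nonneg.mpr (P.mesh_pos 0).le) hA i₀ b₀ c.src (fun i => propagatorK C Ω (A + Y) msq a k (dip C Y c (onb N i))) hK hKd hV
    (fun b hb => by rw [show (1 : ℝ) - 1 = 0 by norm_num]; exact hD b hb) hfar
  refine le_trans (le_of_eq ?_) h
  congr 1
  exact Finset.sum_congr rfl fun i _ => by rw [op116_succ_left_apply, op116_zero_zero_apply]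

/-- **MIXED ENTRY OF `(1.16)_{0,1}`** at far arguments (`θ = ε^{−1}`, states `G_k(Ω,Y)dip_{⟨x′,ν⟩}e_i`, `a_v = 1`; top exponent `1`).
[cite: Balaban1983Higgs3, (1.16) p.414, (2.10) p.426, p.433] [cite: Balaban1982Higgs1, (1.7) p.605, (3.44) p.619] -/
theorem mixed_row_op116_zero_one_le (hL2 : 2 ≤ P.L) (hkK : k ≤ P.K) {δ ρ : ℝ} (hδ : 0 < δ) (hδ1 : δ ≤ 1) (hρ : 1 ≤ ρ)
    {s cK cKd cv cd : ℝ} (hs : 0 ≤ s) (hcK : 0 ≤ cK) (hcKd : 0 ≤ cKd) (hcv : 0 ≤ cv) (hcd : 0 ≤ cd)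
    (hA : ∀ b : HiggsLattice.PBond P 0, |A b| ≤ s) (i₀ : Ix N) (b₀ c : HiggsLattice.PBond P 0)
    (hK : ∀ y, ∑ i : Ix N, ‖covDeriv C Y (propagatorK C Ω (A + Y) msq a k (cb P N 0 (y, i))) b₀‖ ≤ maj P k cK 1 δ b₀.src y)
    (hKd : ∀ b ∈ collB Ω A, (P.mesh 0)⁻¹ * ∑ i : Ix N, ‖covDeriv C Y (propagatorK C Ω (A + Y) msq a k (dip C Y b (onb N i))) b₀‖
      ≤ maj P k cKd 0 δ b.src b₀.src)
    (hV : ∀ u, (P.mesh 0)⁻¹ * ∑ i : Ix N, ‖propagatorK C Ω Y msq a k (dip C Y c (onb N i)) u‖ ≤ maj P k cv 1 δ u c.src)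
    (hD : ∀ b ∈ collB Ω A, (P.mesh 0)⁻¹ * ∑ i : Ix N, ‖covDeriv C Y (propagatorK C Ω Y msq a k (dip C Y c (onb N i))) b‖
      ≤ maj P k cd 0 δ b.src c.src)
    (hfar : ∀ b : HiggsLattice.PBond P 0, A b ≠ 0 → ∀ z : HiggsLattice.Site P 0, blockIter k z = blockIter k b.src →
      Far P k ρ b₀.src z ∧ Far P k ρ z c.src) :
    (P.mesh 0)⁻¹ * ∑ i : Ix N, ‖covDeriv C Y (op116 C Ω A Y msq a k 0 1 (dip C Y c (onb N i))) b₀‖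
      ≤ top P k (farF P δ ρ * collarC P N k δ 1 0 1 cK cKd cv cd (|C.e| * s) 0 ((|C.e| * s) ^ 2) (|C.e| * s) 0
            (|B1.aSeq a P.L k| * (P.mesh k)⁻¹ ^ 2 *
              ((|C.e| * s * P.mesh 0 * (P.d * ((P.L : ℝ) ^ k - 1))) * (2 + |C.e| * s * P.mesh 0 * (P.d * ((P.L : ℝ) ^ k - 1))))))
          1 (δ / 4) b₀.src c.src := by
  have h := deriv_row_collar_le C Ω A Y (A + Y) msq a hL2 hkK hδ hδ1 hρ (av := 1) (θ := (P.mesh 0)⁻¹) hs hcK hcKd hcv hcd le_rfl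
    (inv_nonneg.mpr (P.mesh_pos 0).le) hA i₀ b₀ c.src (fun i => propagatorK C Ω Y msq a k (dip C Y c (onb N i))) hK hKd hV
    (fun b hb => by rw [show (1 : ℝ) - 1 = 0 by norm_num]; exact hD b hb) hfar
  refine le_trans (le_of_eq ?_) h
  congr 1
  exact Finset.sum_congr rfl fun i _ => by rw [op116_succ_right_apply, op116_zero_zero_apply]

end DerivRow

/-! ## §5 The Hölder-row binder at `α = 0` is two derivative rows (triangle inequality, `U(Y(Γ))` an isometry) -/

section HolderZero

variable (C : ChargeData N) (B : HiggsLattice.VecField P 0) {k : ℕ}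

/-- **AT HÖLDER EXPONENT `α = 0` THE TRANSPORTED-DIFFERENCE BINDER OF THE (1.32)-NORM ASSEMBLY IS A CONSEQUENCE OF THE ROW-DERIVATIVE BINDER**:
for any operator `T`, any set of good points and any `C_D, t, δ ≥ 0`, the shape `hDv` of `B3Ineq25Op116Smooth.ineq25At_op116_smooth_of_bounds`
(`(ε^d)^{−1}Σ_{i′}‖(D^ε_BTe_{(x′,i′)})(⟨x,μ⟩)‖ ≤ C_Dt·L^kε((L^kε)^d)^{−1}e^{−δ|x−x′|/L^k}` at good `x, x′`) implies the shape `hH` at `α = 0` with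
`C_H = 2C_D` (`‖U(B(Γ))v − u‖ ≤ ‖v‖ + ‖u‖`, `B1TorusChainTransport.norm_hol_apply`; `e^{−δ|x_i−x′|/L^k} ≤ e^{−δ·min/L^k}`) — so the collar operator's
eight binders at `α = 0` come from §1–§4; the genuine Hölder row (`α > 0`: Leibniz form + face sums) is a later file.
[cite: Balaban1983Higgs3, (1.32) p.420, (2.5) p.424, (1.16) p.414] [cite: Balaban1982Higgs1, (1.7) p.605, Prop. 2.1 (2.24) p.610] -/
theorem holder_row_zero_of_deriv_row (T : Module.End ℝ (ScalarField P 0 N)) (Good : HiggsLattice.Site P 0 → Prop) {CD t δ : ℝ}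
    (hCDt : 0 ≤ CD * t) (hδ : 0 ≤ δ)
    (hDv : ∀ (μ : Fin P.d) (x x' : HiggsLattice.Site P 0), Good x → Good x' →
      (P.mesh 0 ^ P.d)⁻¹ * ∑ i' : Ix N, ‖covDeriv C B (T (cb P N 0 (x', i'))) ⟨x, μ⟩‖
        ≤ CD * t * (P.mesh k * (P.mesh k ^ P.d)⁻¹) * Real.exp (-(δ * ((HiggsLattice.Site.tdist x x' : ℝ) / (P.L : ℝ) ^ k))))
    (μ : Fin P.d) (x₁ x₂ x' : HiggsLattice.Site P 0) (Γ : List (HiggsLattice.Site P 0))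
    (hx₁ : Good x₁) (hx₂ : Good x₂) (hx' : Good x') :
    (P.mesh 0 ^ P.d)⁻¹ * ∑ i' : Ix N, ‖B1TorusChainTransport.hol C B x₁ Γ (covDeriv C B (T (cb P N 0 (x', i'))) ⟨x₂, μ⟩)
        - covDeriv C B (T (cb P N 0 (x', i'))) ⟨x₁, μ⟩‖
      ≤ (P.mesh 0 * (HiggsLattice.Site.tdist x₁ x₂ : ℝ)) ^ (0 : ℝ) *
          ((2 * CD) * t * (P.mesh k * (P.mesh k ^ P.d)⁻¹ * (P.mesh k ^ (0 : ℝ))⁻¹)) *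
          Real.exp (-(δ * (min (HiggsLattice.Site.tdist x₁ x' : ℝ) (HiggsLattice.Site.tdist x₂ x' : ℝ) / (P.L : ℝ) ^ k))) := by
  have hm0 : 0 ≤ (P.mesh 0 ^ P.d)⁻¹ := inv_nonneg.mpr (pow_nonneg (P.mesh_pos 0).le _)
  have hLk : (0 : ℝ) < (P.L : ℝ) ^ k := pow_pos (by exact_mod_cast P.hL) k
  set Emin : ℝ := Real.exp (-(δ * (min (HiggsLattice.Site.tdist x₁ x' : ℝ) (HiggsLattice.Site.tdist x₂ x' : ℝ) / (P.L : ℝ) ^ k))) with hEmin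
  set W : ℝ := CD * t * (P.mesh k * (P.mesh k ^ P.d)⁻¹) with hW
  have hW0 : 0 ≤ W := by rw [hW]; exact mul_nonneg hCDt (mul_nonneg (P.mesh_pos k).le (inv_nonneg.mpr (pow_nonneg (P.mesh_pos k).le _)))
  -- each derivative row is below `W·Emin`
  have hmono : ∀ {D : ℝ}, min (HiggsLattice.Site.tdist x₁ x' : ℝ) (HiggsLattice.Site.tdist x₂ x' : ℝ) ≤ D →
      Real.exp (-(δ * (D / (P.L : ℝ) ^ k))) ≤ Emin := by
    intro D hD
    rw [hEmin, Real.exp_le_exp]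
    have := div_le_div_of_nonneg_right hD hLk.le
    nlinarith
  have h1 : (P.mesh 0 ^ P.d)⁻¹ * ∑ i' : Ix N, ‖covDeriv C B (T (cb P N 0 (x', i'))) ⟨x₁, μ⟩‖ ≤ W * Emin :=
    (hDv μ x₁ x' hx₁ hx').trans (mul_le_mul_of_nonneg_left (hmono (min_le_left _ _)) hW0)
  have h2 : (P.mesh 0 ^ P.d)⁻¹ * ∑ i' : Ix N, ‖covDeriv C B (T (cb P N 0 (x', i'))) ⟨x₂, μ⟩‖ ≤ W * Emin :=
    (hDv μ x₂ x' hx₂ hx').trans (mul_le_mul_of_nonneg_left (hmono (min_le_right _ _)) hW0)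
  -- triangle inequality under the isometry
  have htri : ∑ i' : Ix N, ‖B1TorusChainTransport.hol C B x₁ Γ (covDeriv C B (T (cb P N 0 (x', i'))) ⟨x₂, μ⟩)
        - covDeriv C B (T (cb P N 0 (x', i'))) ⟨x₁, μ⟩‖
      ≤ ∑ i' : Ix N, ‖covDeriv C B (T (cb P N 0 (x', i'))) ⟨x₂, μ⟩‖ + ∑ i' : Ix N, ‖covDeriv C B (T (cb P N 0 (x', i'))) ⟨x₁, μ⟩‖ := by
    rw [← Finset.sum_add_distrib]
    refine Finset.sum_le_sum fun i' _ => (norm_sub_le _ _).trans (le_of_eq ?_)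
    rw [B1TorusChainTransport.norm_hol_apply]
  rw [Real.rpow_zero, Real.rpow_zero, inv_one, mul_one, one_mul]
  calc (P.mesh 0 ^ P.d)⁻¹ * ∑ i' : Ix N, ‖B1TorusChainTransport.hol C B x₁ Γ (covDeriv C B (T (cb P N 0 (x', i'))) ⟨x₂, μ⟩)
          - covDeriv C B (T (cb P N 0 (x', i'))) ⟨x₁, μ⟩‖
      ≤ (P.mesh 0 ^ P.d)⁻¹ * ∑ i' : Ix N, ‖covDeriv C B (T (cb P N 0 (x', i'))) ⟨x₂, μ⟩‖
        + (P.mesh 0 ^ P.d)⁻¹ * ∑ i' : Ix N, ‖covDeriv C B (T (cb P N 0 (x', i'))) ⟨x₁, μ⟩‖ := by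
        rw [← mul_add]; exact mul_le_mul_of_nonneg_left htri hm0
    _ ≤ W * Emin + W * Emin := add_le_add h2 h1
    _ = 2 * CD * t * (P.mesh k * (P.mesh k ^ P.d)⁻¹) * Emin := by rw [hW]; ring

end HolderZero

end Literature.MathematicalPhysics.QuantumFieldTheory.Balaban1983to89.B3Op116CollarKernel

end
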